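import Literature.AlgebraicGeometry.HodgeTheory.HodgeFiltrationModels
import Literature.NumberTheory.Transcendental.ComplexFormsHighType
import HarnessLib

/-!
# No classes of Hodge type `(p, 0)` or `(0, q)` beyond the dimension

Family `hodge`, layer `Literature/AlgebraicGeometry/HodgeTheory`. Companion to `RationalHodgeClasses`
(`HodgeModel n X`, `HodgeModel.hodgePQ`, `IsOfHodgeType`) and `HodgeFiltrationModels`
(`HodgeModel.hodgePQ_eq_bot_iff`, `HodgeModel.pullback_injective`). All proved, from the linear
algebra of `Literature/NumberTheory/Transcendental/ComplexFormsHighType`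
(`hodgePQ_eq_bot_of_finrank_lt_left/right`: on a manifold charted on `E` there are no non-zero forms
of type `(p, 0)`, `p > dim_ℂ E`, or `(0, q)`, `q > dim_ℂ E`) and the dimension of the model space of a
Hodge model (`IsAnalytification.finrank_eq : finrank ℂ A.model = n`):

* `HodgeModel.hodgePQ_zero_right_eq_bot_of_lt`, `HodgeModel.hodgePQ_zero_left_eq_bot_of_lt`: in a Hodge
  model of an `n`-dimensional `X`, `H^{p,0} = 0` for `p > n` and `H^{0,q} = 0` for `q > n`;
* `IsOfHodgeType.eq_zero_of_lt_left`, `IsOfHodgeType.eq_zero_of_lt_right`: a class in `Hᵏ(X(ℂ); ℂ)`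
  of Hodge type `(p, 0)` with `p > n`, or `(0, q)` with `q > n`, is zero — "there are no holomorphic
  `p`-forms for `p > dim X`" (Voisin I, §2.3.1: `Ω^{p,q}_X = Λ^p Ω^{1,0} ⊗ Λ^q Ω^{0,1}`), the step
  "`j̃^* η = 0` in `H⁰(X̃', Ω^r_{X̃'})` as `dim X' < r`" of Voisin II, proof of Thm. 10.17.

* `HodgeModel.hodgePQ_eq_bot_of_two_mul_lt`, `IsOfHodgeType.eq_zero_of_two_mul_lt`,
  `IsOfHodgeType.eq_zero_pp_of_lt`: the type-free vanishing beyond the REAL dimension — in a Hodge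
  model of an `n`-dimensional `X` every `H^{p,q} ⊆ Hᵏ(X^an; ℂ)` with `k > 2n` is `0` (there are no
  non-zero `k`-forms on a `2n`-dimensional real manifold, `hodgePQ_eq_bot_of_two_mul_finrank_lt`), so
  a class in `Hᵏ(X(ℂ); ℂ)` of any Hodge type `(p, q)` with `k > 2n` — in particular a `(p, p)`-class
  in `H²ᵖ` with `p > n` — is zero ("`Hᵏ(X, ℂ) = 0` for `k > 2 dim X`"; the degrees `2p > 2 dim X` of
  the Hodge conjecture, where there is nothing to prove).

Not here: mixed types `(p, q)` with `p > n`, `q > 0`, `p + q ≤ 2n` (equally zero, but the tree's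
weight-based `IsOfType` needs the full type decomposition to see it).

## References

* C. Voisin, *Hodge Theory and Complex Algebraic Geometry I* (2002), §2.3.1, §6.1.
* C. Voisin, *Hodge Theory and Complex Algebraic Geometry II* (2003), proof of Thm. 10.17.
-/

noncomputable section

open CategoryTheory

namespace Literature.AlgebraicGeometry.HodgeTheory

section HodgeTheory

variable {n : ℕ} {X : Motives.SchemeOver ℂ}

/-- **`H^{p,0}(X^an) = 0` for `p > n = dim X`** in every Hodge model: the model space has complex
dimension `n` (`IsAnalytification.finrank_eq`), so there are no non-zero forms of type `(p, 0)`
(`hodgePQ_eq_bot_of_finrank_lt_left`). [cite: VoisinHodgeI2002, §2.3.1] -/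
theorem HodgeModel.hodgePQ_zero_right_eq_bot_of_lt (A : HodgeModel n X) (k : ℕ) {p : ℕ} (hp : n < p) :
    A.hodgePQ k p 0 = ⊥ := by
  rw [A.hodgePQ_eq_bot_iff]
  exact Literature.NumberTheory.Transcendental.hodgePQ_eq_bot_of_finrank_lt_left A.carrier
    (by rw [A.isAnalytification.finrank_eq]; exact hp)

/-- **`H^{0,q}(X^an) = 0` for `q > n = dim X`** in every Hodge model (conjugate statement,
`hodgePQ_eq_bot_of_finrank_lt_right`). [cite: VoisinHodgeI2002, §2.3.1] -/
theorem HodgeModel.hodgePQ_zero_left_eq_bot_of_lt (A : HodgeModel n X) (k : ℕ) {q : ℕ} (hq : n < q) :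
    A.hodgePQ k 0 q = ⊥ := by
  rw [A.hodgePQ_eq_bot_iff]
  exact Literature.NumberTheory.Transcendental.hodgePQ_eq_bot_of_finrank_lt_right A.carrier
    (by rw [A.isAnalytification.finrank_eq]; exact hq)

/-- **A class of Hodge type `(p, 0)` with `p > dim X` is zero**: its pull-back to a Hodge model lies
in `H^{p,0} = 0`, and the pull-back `Hᵏ(X(ℂ); ℂ) → Hᵏ(X^an; ℂ)` is injective. In particular an
`n`-dimensional smooth projective variety carries no non-zero class of type `(p, 0)`, `p > n` (no
holomorphic `p`-forms). [cite: VoisinHodgeI2002, §2.3.1] [cite: VoisinHodgeII2003, proof of Thm. 10.17] -/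
theorem IsOfHodgeType.eq_zero_of_lt_left {k p : ℕ}
    {c : Literature.AlgebraicTopology.SingularHomology.singularCohomology ℂ ℂ (Motives.ComplexPoints X) k}
    (hc : IsOfHodgeType n X k p 0 c) (hp : n < p) : c = 0 := by
  obtain ⟨A, hA⟩ := hc
  rw [A.hodgePQ_zero_right_eq_bot_of_lt k hp, Submodule.mem_bot] at hA
  exact A.pullback_injective k (by rw [hA, map_zero])

/-- **A class of Hodge type `(0, q)` with `q > dim X` is zero** (conjugate statement).
[cite: VoisinHodgeI2002, §2.3.1] -/
theorem IsOfHodgeType.eq_zero_of_lt_right {k q : ℕ}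
    {c : Literature.AlgebraicTopology.SingularHomology.singularCohomology ℂ ℂ (Motives.ComplexPoints X) k}
    (hc : IsOfHodgeType n X k 0 q c) (hq : n < q) : c = 0 := by
  obtain ⟨A, hA⟩ := hc
  rw [A.hodgePQ_zero_left_eq_bot_of_lt k hq, Submodule.mem_bot] at hA
  exact A.pullback_injective k (by rw [hA, map_zero])

/-! ### Beyond the real dimension: no classes of any type in degree `k > 2n` -/

/-- **`H^{p,q}(X^an) = 0` in degree `k > 2n = dim_ℝ X^an`** in every Hodge model, for every `(p, q)`:
the model space has complex dimension `n` (`IsAnalytification.finrank_eq`), so there are no non-zero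
`k`-forms at all (`hodgePQ_eq_bot_of_two_mul_finrank_lt`). Voisin I, §2.3.1, Rem. 2.24
(`Ω^k_{X,ℂ} = ⊕_{p+q=k} Ω^{p,q}`, zero for `k > 2n`). [cite: VoisinHodgeI2002, §2.3.1] -/
theorem HodgeModel.hodgePQ_eq_bot_of_two_mul_lt (A : HodgeModel n X) {k : ℕ} (hk : 2 * n < k)
    (p q : ℕ) : A.hodgePQ k p q = ⊥ := by
  rw [A.hodgePQ_eq_bot_iff]
  exact Literature.NumberTheory.Transcendental.hodgePQ_eq_bot_of_two_mul_finrank_lt A.carrier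
    (by rw [A.isAnalytification.finrank_eq]; exact hk) p q

/-- **A class of Hodge type `(p, q)` in degree `k > 2 dim X` is zero**: its pull-back to a Hodge
model lies in `H^{p,q} = 0` (`HodgeModel.hodgePQ_eq_bot_of_two_mul_lt`), and the pull-back
`Hᵏ(X(ℂ); ℂ) → Hᵏ(X^an; ℂ)` is injective. ("`Hᵏ(X, ℂ) = ⊕_{p+q=k} H^{p,q}(X) = 0` for `k > 2n`.")
[cite: VoisinHodgeI2002, §2.3.1 and §6.1.3] -/
theorem IsOfHodgeType.eq_zero_of_two_mul_lt {k p q : ℕ}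
    {c : Literature.AlgebraicTopology.SingularHomology.singularCohomology ℂ ℂ (Motives.ComplexPoints X) k}
    (hc : IsOfHodgeType n X k p q c) (hk : 2 * n < k) : c = 0 := by
  obtain ⟨A, hA⟩ := hc
  rw [A.hodgePQ_eq_bot_of_two_mul_lt hk, Submodule.mem_bot] at hA
  exact A.pullback_injective k (by rw [hA, map_zero])

/-- **No `(p, p)`-classes in `H²ᵖ(X(ℂ); ℂ)` for `p > dim X`** (the case `k = 2p`, `q = p` of
`IsOfHodgeType.eq_zero_of_two_mul_lt`): the degrees of the Hodge conjecture above the dimension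
are empty. [cite: VoisinHodgeI2002, §2.3.1 and §6.1.3] -/
theorem IsOfHodgeType.eq_zero_pp_of_lt {p : ℕ}
    {c : Literature.AlgebraicTopology.SingularHomology.singularCohomology ℂ ℂ (Motives.ComplexPoints X) (2 * p)}
    (hc : IsOfHodgeType n X (2 * p) p p c) (hp : n < p) : c = 0 :=
  hc.eq_zero_of_two_mul_lt (by omega)

end HodgeTheory

end Literature.AlgebraicGeometry.HodgeTheory

end
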